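import Mathlib
import Summits.PneNP.PneNP.Theorems.ClusUniversalCertificateCoordDefs
import Summits.PneNP.PneNP.Theorems.ClusUniversalCertificateCoordColumns
import Summits.PneNP.PneNP.Theorems.ClusUniversalCertificateCoordFrame
import Summits.PneNP.PneNP.Theorems.ClusUniversalCertificateOPlusDefs

/-!
# Route ClusUniversalCertificate — (⊕) ⇒ the mixed universal certificate (crux `UniversalCertAll`, stmt-PneNP-19683)

Rung F-N1, cell pnp-ideate; planner p1 g7's ask (ROUND-7 §6g (ii), STATUS 2026-08-27T14:08Z «ASK (provers, S): land
(⊕) ⇒ UCMixDim»).  PROVED HERE, sorry-free: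

* `qpotDom : QPotDom` — the one-block potential `(b − 1) + 2^b·[c = 0]` dominates `dsum` on every `S ⊆ 𝔽₂^b`
  (`S = 𝔽₂^b`: both sides equal `b·2^b`; otherwise every point has certificate codimension `≥ 1`,
  `ClusCoordTwoBlocks.one_le_acodim`).
* `ucMix_iff_dsum_le_bpot` — `UCMix M n blk Y ↔ dsum Y ≤ Σ_{y∈Y} bpot blk y` (the mixed certificate IS domination
  of the block potential on `Y`).
* `isDomPot_bpot : OPlusAll → ∀ n M blk, IsDomPot M (bpot blk)` — induction on the number of blocks: sort the last
  block to a final segment (`exists_sorted`, a bijection `Fin (a+b) ≃ Fin M`), identify the block potential with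
  `dplus (bpot blk') (qpot b)` there (`dplus_bpot_qpot_eq`), apply (⊕) to the induction hypothesis and `qpotDom`,
  and transport back along the coordinate permutation (`isDomPot_of_comp_perm`, via
  `ClusCoordFrame.dsum_image_linearEquiv`; `bpot_comp_perm`).
* `oplusImpliesUC : OPlusImpliesUC`, i.e. `OPlusAll → ∀ M, UCMixDim M`; pointwise `ucMix_of_oplusAll`.

With the landed `ClusCoord.stub_transfer` this makes the crux `UniversalCertAll` follow from (⊕) ALONE
(p1's `UniversalCertAll_of_oplus`).  HONEST FRAMING: (⊕) is p1's OPEN conjecture (kit censuses running); this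
file proves only the reduction; FRONTIER rung F-N1 — nothing here bears on P vs NP.
-/

set_option linter.dupNamespace false -- `Summit.PneNP.PneNP.…`: summit = sub-problem name (D-0017 single-conjunct layout)

namespace Summit.PneNP.PneNP.Theorems.ClusCoordOPlus

open Finset Summit.PneNP.PneNP.Theorems.ClusCoord Summit.PneNP.PneNP.Theorems.ClusCoordTwoBlocks
  Summit.PneNP.PneNP.Theorems.ClusCoordFrame

/-! ## `UCMix` as domination of the block potential -/

section Basic

variable {M n : ℕ}

/-- The block potential in `ℤ`, cast to `ℚ`, is `bpot`. -/
theorem bpot_eq_cast (blk : Fin M → Fin n) (y : Fin M → ZMod 2) :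
    bpot blk y = ((∑ j : Fin n, (((bsize blk j : ℤ) - 1) +
      if (∀ i, blk i = j → y i = 0) then (2 : ℤ) ^ (bsize blk j) else 0) : ℤ) : ℚ) := by
  unfold bpot
  push_cast
  refine Finset.sum_congr rfl fun j _ => ?_
  split_ifs <;> simp

/-- `UCMix M n blk Y` is literally «the block potential dominates `dsum` on `Y`». -/
theorem ucMix_iff_dsum_le_bpot (blk : Fin M → Fin n) (Y : Finset (Fin M → ZMod 2)) :
    UCMix M n blk Y ↔ ((dsum M Y : ℤ) : ℚ) ≤ ∑ y ∈ Y, bpot blk y := by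
  classical
  -- integer form of the right-hand side
  have hZ : ∀ j : Fin n, (zcount blk j Y : ℤ) = ∑ y ∈ Y, (if (∀ i, blk i = j → y i = 0) then (1 : ℤ) else 0) := by
    intro j
    unfold zcount
    rw [Finset.card_filter]
    push_cast
    rfl
  have hR : ∑ j : Fin n, (2 : ℤ) ^ (bsize blk j) * (zcount blk j Y : ℤ)
      = ∑ y ∈ Y, ∑ j : Fin n, (if (∀ i, blk i = j → y i = 0) then (2 : ℤ) ^ (bsize blk j) else 0) := by
    rw [Finset.sum_comm]
    refine Finset.sum_congr rfl fun j _ => ?_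
    rw [hZ j, Finset.mul_sum]
    refine Finset.sum_congr rfl fun y _ => ?_
    split_ifs <;> simp
  have hL : ∑ y ∈ Y, (((M : ℤ) - (acodim M Y y : ℤ)) - ∑ j : Fin n, ((bsize blk j : ℤ) - 1))
      = dsum M Y - ∑ y ∈ Y, ∑ j : Fin n, ((bsize blk j : ℤ) - 1) := by
    unfold dsum
    rw [← Finset.sum_sub_distrib]
  have hcast : (∑ y ∈ Y, bpot blk y) = ((∑ y ∈ Y, ∑ j : Fin n, (((bsize blk j : ℤ) - 1) +
      if (∀ i, blk i = j → y i = 0) then (2 : ℤ) ^ (bsize blk j) else 0) : ℤ) : ℚ) := by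
    push_cast
    refine Finset.sum_congr rfl fun y _ => ?_
    rw [bpot_eq_cast]
    push_cast
    rfl
  rw [hcast, Int.cast_le]
  unfold UCMix
  rw [hR, hL]
  constructor
  · intro h
    have : ∑ y ∈ Y, ∑ j : Fin n, (((bsize blk j : ℤ) - 1) +
        if (∀ i, blk i = j → y i = 0) then (2 : ℤ) ^ (bsize blk j) else 0)
        = ∑ y ∈ Y, ∑ j : Fin n, ((bsize blk j : ℤ) - 1)
          + ∑ y ∈ Y, ∑ j : Fin n, (if (∀ i, blk i = j → y i = 0) then (2 : ℤ) ^ (bsize blk j) else 0) := by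
      rw [← Finset.sum_add_distrib]
      refine Finset.sum_congr rfl fun y _ => ?_
      rw [← Finset.sum_add_distrib]
    rw [this]; linarith
  · intro h
    have : ∑ y ∈ Y, ∑ j : Fin n, (((bsize blk j : ℤ) - 1) +
        if (∀ i, blk i = j → y i = 0) then (2 : ℤ) ^ (bsize blk j) else 0)
        = ∑ y ∈ Y, ∑ j : Fin n, ((bsize blk j : ℤ) - 1)
          + ∑ y ∈ Y, ∑ j : Fin n, (if (∀ i, blk i = j → y i = 0) then (2 : ℤ) ^ (bsize blk j) else 0) := by
      rw [← Finset.sum_add_distrib]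
      refine Finset.sum_congr rfl fun y _ => ?_
      rw [← Finset.sum_add_distrib]
    rw [this] at h; linarith

/-- `dsum` cast to `ℚ`, expanded. -/
theorem cast_dsum (S : Finset (Fin M → ZMod 2)) :
    ((dsum M S : ℤ) : ℚ) = ∑ y ∈ S, ((M : ℚ) - (acodim M S y : ℚ)) := by
  unfold dsum
  push_cast
  rfl

/-- **`QPotDom`**: the one-block potential `(b − 1) + 2^b·[c = 0]` dominates `dsum` on every `S ⊆ 𝔽₂^b`
(if `S = 𝔽₂^b` both sides are `b·2^b`; otherwise every point of `S` has certificate codimension `≥ 1`). -/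
theorem qpotDom : QPotDom := by
  classical
  intro b S
  rw [cast_dsum]
  by_cases hS : S = univ
  · subst hS
    have hcard : ((univ : Finset (Fin b → ZMod 2)).card : ℚ) = (2 : ℚ) ^ b := by
      rw [card_univ, Fintype.card_fun, ZMod.card, Fintype.card_fin]; push_cast; rfl
    have hl : ∑ y ∈ (univ : Finset (Fin b → ZMod 2)), ((b : ℚ) - (acodim b univ y : ℚ)) = (2 : ℚ) ^ b * b := by
      rw [Finset.sum_congr rfl fun y _ => by rw [acodim_univ, Nat.cast_zero, sub_zero], sum_const,
        nsmul_eq_mul, hcard]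
    have hr : ∑ c ∈ (univ : Finset (Fin b → ZMod 2)), qpot b c = (2 : ℚ) ^ b * ((b : ℚ) - 1) + (2 : ℚ) ^ b := by
      unfold qpot
      rw [sum_add_distrib, sum_const, nsmul_eq_mul, hcard, Finset.sum_ite_eq' univ (0 : Fin b → ZMod 2)]
      simp
    rw [hl, hr]
    linarith
  · refine Finset.sum_le_sum fun y hy => ?_
    have h1 : (1 : ℚ) ≤ (acodim b S y : ℚ) := by exact_mod_cast one_le_acodim hS hy
    unfold qpot
    have h2 : (0 : ℚ) ≤ if y = 0 then (2 : ℚ) ^ b else 0 := by split_ifs <;> positivity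
    linarith

end Basic

/-! ## Transport along coordinate permutations -/

section Perm

variable {M n : ℕ}

/-- Domination is transported along a coordinate permutation of `𝔽₂^M`. -/
theorem isDomPot_of_comp_perm (τ : Fin M ≃ Fin M) (p : (Fin M → ZMod 2) → ℚ)
    (h : IsDomPot M (fun z => p (z ∘ τ))) : IsDomPot M p := by
  classical
  intro S
  let g : (Fin M → ZMod 2) ≃ₗ[ZMod 2] (Fin M → ZMod 2) := LinearEquiv.funCongrLeft (ZMod 2) (ZMod 2) τ.symm
  have hg : ∀ y : Fin M → ZMod 2, g y = y ∘ τ.symm := fun y => rfl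
  have h1 := h (S.image fun y => g y)
  rw [dsum_image_linearEquiv S g, Finset.sum_image fun a _ b _ hab => g.injective hab] at h1
  refine h1.trans (le_of_eq (Finset.sum_congr rfl fun y _ => ?_))
  rw [hg]
  congr 1
  funext i
  simp

/-- Block sizes are invariant under relabelling the coordinates by a permutation. -/
theorem bsize_comp_perm (σ : Fin M ≃ Fin M) (blk : Fin M → Fin n) (j : Fin n) :
    bsize (fun i => blk (σ i)) j = bsize blk j := by
  unfold bsize
  rw [← Fintype.card_subtype, ← Fintype.card_subtype]
  exact Fintype.card_congr (σ.subtypeEquiv fun i => Iff.rfl)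

/-- The block potential of the relabelled block map is the block potential at the relabelled point. -/
theorem bpot_comp_perm (σ : Fin M ≃ Fin M) (blk : Fin M → Fin n) (z : Fin M → ZMod 2) :
    bpot (fun i => blk (σ i)) z = bpot blk (z ∘ σ.symm) := by
  unfold bpot
  refine Finset.sum_congr rfl fun j _ => ?_
  rw [bsize_comp_perm]
  have hiff : (∀ i, blk (σ i) = j → z i = 0) ↔ (∀ i, blk i = j → (z ∘ σ.symm) i = 0) := by
    constructor
    · intro h i hi
      have := h (σ.symm i) (by simpa using hi)
      simpa using this
    · intro h i hi
      have := h (σ i) hi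
      simpa using this
  simp only [hiff]

end Perm

/-! ## Sorting a block map: the last block as a contiguous final segment -/

section Sorting

variable {M n : ℕ}

/-- Every block map `blk : Fin M → Fin (n+1)` becomes, after a bijection `Fin (a + b) ≃ Fin M`, one whose last
block is exactly the final segment of length `b`. -/
theorem exists_sorted (blk : Fin M → Fin (n + 1)) :
    ∃ a b : ℕ, ∃ _h : a + b = M, ∃ σ : Fin (a + b) ≃ Fin M,
      (∀ i : Fin a, blk (σ (Fin.castAdd b i)) ≠ Fin.last n) ∧
      (∀ k : Fin b, blk (σ (Fin.natAdd a k)) = Fin.last n) := by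
  classical
  let p : Fin M → Prop := fun i => blk i ≠ Fin.last n
  let a := Fintype.card {i // p i}
  let b := Fintype.card {i // ¬ p i}
  have hab : a + b = M := by
    have := Fintype.card_congr (Equiv.sumCompl p)
    rw [Fintype.card_sum, Fintype.card_fin] at this
    exact this
  let eA : {i // p i} ≃ Fin a := Fintype.equivFin _
  let eB : {i // ¬ p i} ≃ Fin b := Fintype.equivFin _
  let σ : Fin (a + b) ≃ Fin M :=
    finSumFinEquiv.symm.trans ((eA.symm.sumCongr eB.symm).trans (Equiv.sumCompl p))
  refine ⟨a, b, hab, σ, fun i => ?_, fun k => ?_⟩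
  · have : σ (Fin.castAdd b i) = ((eA.symm i : {i // p i}) : Fin M) := by
      simp [σ, Equiv.trans_apply, finSumFinEquiv_symm_apply_castAdd, Equiv.sumCongr_apply,
        Equiv.sumCompl_apply_inl]
    rw [this]
    exact (eA.symm i).2
  · have : σ (Fin.natAdd a k) = ((eB.symm k : {i // ¬ p i}) : Fin M) := by
      simp [σ, Equiv.trans_apply, finSumFinEquiv_symm_apply_natAdd, Equiv.sumCongr_apply,
        Equiv.sumCompl_apply_inr]
    rw [this]
    exact not_not.1 (eB.symm k).2

/-- Cardinality of a filter of `Fin (a + b)` split into the two segments. -/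
theorem card_filter_fin_add {a b : ℕ} (P : Fin (a + b) → Prop) [DecidablePred P] :
    (univ.filter P).card
      = (univ.filter fun i : Fin a => P (Fin.castAdd b i)).card
        + (univ.filter fun k : Fin b => P (Fin.natAdd a k)).card := by
  rw [Finset.card_filter, Finset.card_filter, Finset.card_filter, Fin.sum_univ_add]

/-- In the sorted situation the block potential of `blk₁` IS the direct sum of the block potential of the
first `n` blocks (restricted to the first segment) and the one-block potential of the last block. -/
theorem dplus_bpot_qpot_eq {a b : ℕ} (blk₁ : Fin (a + b) → Fin (n + 1))
    (hA : ∀ i : Fin a, blk₁ (Fin.castAdd b i) ≠ Fin.last n)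
    (hB : ∀ k : Fin b, blk₁ (Fin.natAdd a k) = Fin.last n)
    (blk' : Fin a → Fin n) (hblk' : ∀ i, (blk' i).castSucc = blk₁ (Fin.castAdd b i))
    (z : Fin (a + b) → ZMod 2) :
    dplus (bpot blk') (qpot b) z = bpot blk₁ z := by
  classical
  unfold dplus bpot qpot
  rw [Fin.sum_univ_castSucc]
  -- block sizes
  have hsz : ∀ j : Fin n, bsize blk₁ j.castSucc = bsize blk' j := by
    intro j
    unfold bsize
    rw [card_filter_fin_add]
    have h2 : (univ.filter fun k : Fin b => blk₁ (Fin.natAdd a k) = j.castSucc).card = 0 := by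
      rw [Finset.card_eq_zero, Finset.filter_eq_empty_iff]
      intro k _ hk
      rw [hB k] at hk
      exact (Fin.castSucc_lt_last j).ne hk.symm
    rw [h2, add_zero]
    congr 1
    ext i
    simp only [Finset.mem_filter, Finset.mem_univ, true_and]
    rw [← hblk' i]
    exact Fin.castSucc_inj
  have hszl : bsize blk₁ (Fin.last n) = b := by
    unfold bsize
    rw [card_filter_fin_add]
    have h1 : (univ.filter fun i : Fin a => blk₁ (Fin.castAdd b i) = Fin.last n).card = 0 := by
      rw [Finset.card_eq_zero, Finset.filter_eq_empty_iff]
      intro i _ hi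
      exact hA i hi
    have h2 : (univ.filter fun k : Fin b => blk₁ (Fin.natAdd a k) = Fin.last n) = univ :=
      Finset.filter_true_of_mem fun k _ => hB k
    rw [h1, h2, zero_add, card_univ, Fintype.card_fin]
  -- zero tests
  have hzt : ∀ j : Fin n, (∀ i : Fin (a + b), blk₁ i = j.castSucc → z i = 0)
      ↔ (∀ i : Fin a, blk' i = j → z (Fin.castAdd b i) = 0) := by
    intro j
    constructor
    · intro h i hi
      exact h _ (by rw [← hblk' i, hi])
    · intro h i hi
      induction i using Fin.addCases with
      | left i₀ =>
        apply h
        have := hblk' i₀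
        rw [hi] at this
        exact Fin.castSucc_inj.1 this
      | right k =>
        exfalso
        rw [hB k] at hi
        exact (Fin.castSucc_lt_last j).ne hi.symm
  have hztl : (∀ i : Fin (a + b), blk₁ i = Fin.last n → z i = 0)
      ↔ (fun k : Fin b => z (Fin.natAdd a k)) = 0 := by
    rw [funext_iff]
    constructor
    · intro h k
      exact h _ (hB k)
    · intro h i hi
      induction i using Fin.addCases with
      | left i₀ => exact absurd hi (hA i₀)
      | right k => exact h k
  simp only [hsz, hszl, hzt, hztl]

end Sorting

/-! ## The induction on the number of blocks -/

/-- **(⊕) ⇒ the block potential is dominating**, for every block map, by induction on the number of blocks: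
sort the last block to the end, split `𝔽₂^(a+b) = 𝔽₂^a × 𝔽₂^b`, apply (⊕) to the induction hypothesis and
`qpotDom`, and transport back along the sorting permutation. -/
theorem isDomPot_bpot (hO : OPlusAll) : ∀ (n M : ℕ) (blk : Fin M → Fin n), IsDomPot M (bpot blk) := by
  intro n
  induction n with
  | zero =>
    intro M blk S
    cases M with
    | zero =>
      rw [cast_dsum]
      refine (Finset.sum_nonpos fun y _ => ?_).trans (Finset.sum_nonneg fun y _ => ?_)
      · simp only [Nat.cast_zero, zero_sub, Left.neg_nonpos_iff]
        exact Nat.cast_nonneg _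
      · unfold bpot
        simp
    | succ M' => exact Fin.elim0 (blk 0)
  | succ n ih =>
    intro M blk
    obtain ⟨a, b, hab, σ, hA, hB⟩ := exists_sorted blk
    subst hab
    -- the sorted block map and its first `n` blocks
    let blk₁ : Fin (a + b) → Fin (n + 1) := fun i => blk (σ i)
    have hA₁ : ∀ i : Fin a, blk₁ (Fin.castAdd b i) ≠ Fin.last n := hA
    have hB₁ : ∀ k : Fin b, blk₁ (Fin.natAdd a k) = Fin.last n := hB
    let blk' : Fin a → Fin n := fun i => (blk₁ (Fin.castAdd b i)).castPred (hA₁ i)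
    have hblk' : ∀ i, (blk' i).castSucc = blk₁ (Fin.castAdd b i) := fun i => Fin.castSucc_castPred _ _
    -- (⊕) applied to the induction hypothesis and the one-block potential
    have h1 : IsDomPot (a + b) (dplus (bpot blk') (qpot b)) := hO a b _ _ (ih a blk') (qpotDom b)
    have h2 : IsDomPot (a + b) (bpot blk₁) := by
      intro S
      refine (h1 S).trans (le_of_eq (Finset.sum_congr rfl fun z _ => ?_))
      exact dplus_bpot_qpot_eq blk₁ hA₁ hB₁ blk' hblk' z
    -- transport back along `σ`
    refine isDomPot_of_comp_perm σ.symm (bpot blk) ?_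
    intro S
    refine (h2 S).trans (le_of_eq (Finset.sum_congr rfl fun z _ => ?_))
    exact bpot_comp_perm σ blk z

/-- **`OPlusImpliesUC`** (p1 §6g (ii), the support theorem): the direct-sum conjecture (⊕) implies the mixed
universal certificate `UCMixDim M` in every total dimension `M`. -/
theorem oplusImpliesUC : OPlusImpliesUC := fun hO M n blk Y =>
  (ucMix_iff_dsum_le_bpot blk Y).2 (isDomPot_bpot hO n M blk Y)

/-- Pointwise form: under (⊕), `UCMix M n blk Y` for all data. -/
theorem ucMix_of_oplusAll (hO : OPlusAll) (M n : ℕ) (blk : Fin M → Fin n) (Y : Finset (Fin M → ZMod 2)) :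
    UCMix M n blk Y :=
  oplusImpliesUC hO M n blk Y

end Summit.PneNP.PneNP.Theorems.ClusCoordOPlus
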